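import Summits.ABC.StewartYu.ArchG3RecSched
import HarnessLib

/-!
# Cell abc-stewartyu, rung A1.L (crux r2 `ArchCoreRat`), WP-L.A: the ATOMS of the Siegel line (L1) of the START on the record of reference —
# letters of `ArchG3Rec` at level 0 and the n-UNIFORM DEPTH ATOM `n·(Ŝ+1) ≤ 4L`

`Summits/ABC/StewartYu/ArchG3RecSiegelAtoms.lean` — cell `abc-stewartyu` (HOME `run/shared/lean/pub/abc-stewartyu/`; «lp-1 takes (L1)» STATUS
2026-08-27 20:3xZ after p1 g11's open offer (r2-a) 19:49:57Z; referee acceptance criterion ref g37 20:09:30Z: n-uniform, Stirling with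
`√(2πn)`, a `2^{−n}`-class depth atom — not the `4(Ŝ+2) ≤ L` floor).  Theorems on `ArchG3Rec`; no definition, no named fact.

THE LINE: `2·((2X₀+1)·C(T₀+n−1, n))·(2⌈(Σⱼσⱼ·Aⱼ)/w₀⌉₊+1)·Nⁿ ≤ (L₀+1)·N·∏ⱼ(2⌊N·σⱼ⌋₊+1)`, `X₀ = Nf 0 0 = Xs 0`, `T₀ = Tf 0 0 = Mord 0 0`,
`w₀ = wl 0 = L·e^{−(G+2)}`, `σⱼ = L/(2Aⱼ)`, `L₀ = ⌈6X·C_bⁿ·Ω·K/N⌉`, `C_b = 2e·c_M = 32e` EXACTLY.  LEDGER (every `n ≥ 1`):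
* `Σⱼσⱼ·Aⱼ = nL/2`, `∏ⱼσⱼ = Lⁿ/(2ⁿΩ)`; the class count `2⌈n·e^{G+2}/2⌉₊ + 1 ≤ K + 2` (`K = ⌈n·e^{G+2}⌉₊ + 1`); `Xs 0 ≤ X/2 + 1` (`G = 8(n+1)`);
* `Mord 0 0 ≤ 16(n+1)L·(1 + 1/(n+2)³) + (n+1)·Ŝ` (`R 1 ≤ 8L + Ŝ`, geometric), and the DEPTH ATOM **`n·(Ŝ + 1) ≤ 4L`** from
  `Ŝ = n + 24 + ⌊log₂(K·N)⌋`, `K ≤ n·e^{8n+10} + 2`, `N ≤ (2/log 2)ⁿ·Ω`, `L ≥ 2^{n+25}` and `L·(1 + log N) ≥ 48·C_bⁿ·Ω·K` (`core_le_L`,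
  `yload_K ≥ 2G`, `W/WN ≥ 1/(1 + log N)`), `log Ω ≤ 2√Ω`;
* `C(T₀+n−1, n) ≤ (T₀+n−1)ⁿ/n! ≤ (16e·L)ⁿ·e·e^{nδ}/√(2πn)` (Stirling `√(2πn)(n/e)ⁿ ≤ n!`, `(1+1/n)ⁿ ≤ e`) with
  `nδ ≤ n/(n+2)³ + n(Ŝ+1)/(16L) ≤ 0.3`, `e^{0.3} ≤ 10/7`;
* `(L₀+1)·N ≥ 6X·C_bⁿ·Ω·K`, `2⌊x⌋₊ + 1 ≥ x`; so RHS `≥ 6XK·Nⁿ·(16e·L)ⁿ` and LHS `≤ 2(X+3)(K+2)·(16e·L)ⁿ·e·(10/7)/2.5·Nⁿ ≤ 3.2·XK·…`.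
THIS FILE: the letters (`sum_σ_mul_A`, `prod_σ`, `Cb_eq`, `classCount_le`, `Xs_zero_le`, `R_one_le`, `Mord_zero_le`) and the depth atom
(`log_K_le`, `log_N_le`, `core_le_L_mul`, `log_Ω_le_sqrt`, `depth_poly_le`, `depth_logΩ_le`, `n_mul_Sd_le`); the line itself is `ArchG3RecSiegel`.

WHAT THIS IS NOT: the letter bounds on `AmaxR` (record, seat p1); no crux moves.

References: Yu. V. Nesterenko, LNM 1819 (2003) §3.3 Prop. 3.4, §3.5 (3.22)–(3.24), Prop. 3.9 (the count of the linear system), p. 66–76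
[Nesterenko2003]; E. M. Matveev, Izv. Math. 64 (2000) §3 [Matveev2000].
-/

noncomputable section

open Finset Real
open scoped Nat

namespace Summit.ABC.StewartYu

namespace ArchG3Rec

open PadicG3Par (cG cM Cb cG_pos Cb_pos)
open ArchG3Par (G K SdK yloadK G_eq eight_le_G G_pos one_le_K K_pos two_G_le_yloadK yloadK_pos mul_exp_le_K K_le)

variable {n : ℕ} (P : ArchG3Rec n)

/-! ### Elementary letters -/

/-- `Σⱼ σⱼ·Aⱼ = n·L/2`. [folklore] -/
theorem sum_σ_mul_A : ∑ j, P.σ j * P.A j = n * P.L / 2 := by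
  have h : ∀ j, P.σ j * P.A j = P.L / 2 := by
    intro j
    unfold ArchG3Rec.σ
    have := (P.A_facts j).1
    field_simp
  simp_rw [h]
  rw [sum_const, card_univ, Fintype.card_fin, nsmul_eq_mul]
  ring

/-- `∏ⱼ σⱼ = Lⁿ/(2ⁿ·Ω)`. [folklore] -/
theorem prod_σ : ∏ j, P.σ j = (P.L : ℝ) ^ n / ((2 : ℝ) ^ n * P.Ω) := by
  unfold ArchG3Rec.σ ArchG3Rec.Ω
  rw [prod_div_distrib, prod_const, card_univ, Fintype.card_fin, prod_mul_distrib, prod_const, card_univ, Fintype.card_fin]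

/-- `C_b = 32e`. [folklore] -/
theorem Cb_eq : Cb = 32 * exp 1 := by unfold Cb cM; push_cast; ring

/-- The class count of the slab pigeonhole: `2⌈(Σσⱼ·Aⱼ)/wl 0⌉₊ + 1 ≤ K + 2`. [cite: Matveev2000, §3; shape only] -/
theorem classCount_le : (((2 * ⌈(∑ j, P.σ j * P.A j) / P.wl 0⌉₊ + 1 : ℕ)) : ℝ) ≤ K n + 2 := by
  rw [P.sum_σ_mul_A]
  have hL := P.L_real.2.1
  have hw : P.wl 0 = (P.L : ℝ) * exp (-(G n + 2)) := by unfold ArchG3Rec.wl; simp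
  have hq : (n : ℝ) * P.L / 2 / P.wl 0 = n * exp (G n + 2) / 2 := by
    rw [hw, Real.exp_neg]; field_simp
  rw [hq]
  have h0 : 0 ≤ (n : ℝ) * exp (G n + 2) / 2 := by positivity
  have hc : (⌈(n : ℝ) * exp (G n + 2) / 2⌉₊ : ℝ) < n * exp (G n + 2) / 2 + 1 := Nat.ceil_lt_add_one h0
  have hK : (n : ℝ) * exp (G n + 2) + 1 ≤ K n := by
    unfold K; push_cast
    have := Nat.le_ceil ((n : ℝ) * Real.exp (G n + 2))
    linarith
  push_cast
  linarith

/-- `Xs 0 ≤ X/2 + 1` (the capped level-`0` range; `G = 8(n+1)`). [cite: Nesterenko2003, (4.3); shape only] -/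
theorem Xs_zero_le : (P.Xs 0 : ℝ) ≤ P.X / 2 + 1 := by
  have h1 : P.Xs 0 ≤ ⌊(2 : ℝ) ^ 0 * G n * P.X / (16 * (n + 1))⌋₊ + 1 := by unfold ArchG3Rec.Xs; exact min_le_left _ _
  have h2 : (2 : ℝ) ^ 0 * G n * P.X / (16 * (n + 1)) = P.X / 2 := by
    rw [G_eq, pow_zero, one_mul]
    have : (0 : ℝ) < (n : ℝ) + 1 := by positivity
    field_simp
    ring
  have h3 : (⌊(2 : ℝ) ^ 0 * G n * P.X / (16 * (n + 1))⌋₊ : ℝ) ≤ P.X / 2 := by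
    rw [h2]; exact Nat.floor_le (by positivity)
  calc (P.Xs 0 : ℝ) ≤ ((⌊(2 : ℝ) ^ 0 * G n * P.X / (16 * (n + 1))⌋₊ + 1 : ℕ) : ℝ) := by exact_mod_cast h1
    _ ≤ P.X / 2 + 1 := by push_cast; linarith

/-- `Σ_{s ∈ [1, m]} c/2^s = c·(1 − 1/2^m)`. [folklore] -/
theorem sum_Icc_div_two_pow (c : ℝ) (m : ℕ) : ∑ s ∈ Icc 1 m, c / (2 : ℝ) ^ s = c * (1 - 1 / (2 : ℝ) ^ m) := by
  induction m with
  | zero => simp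
  | succ k ih =>
    rw [Finset.sum_Icc_succ_top (by omega), ih, pow_succ]
    field_simp
    ring

/-- `R 1 ≤ 8L + Ŝ`. [folklore] -/
theorem R_one_le : (P.R 1 : ℝ) ≤ 8 * P.L + P.Sd := by
  unfold ArchG3Rec.R
  push_cast
  have h1 : ∀ s ∈ Icc 1 P.Sd, ((P.T s : ℕ) : ℝ) ≤ 8 * (P.L : ℝ) / (2 : ℝ) ^ s + 1 := by
    intro s _
    unfold ArchG3Rec.T
    rcases le_total (8 * P.L / 2 ^ s) 1 with h | h
    · rw [max_eq_left h]; push_cast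
      have : (0 : ℝ) ≤ 8 * (P.L : ℝ) / (2 : ℝ) ^ s := by positivity
      linarith
    · rw [max_eq_right h]
      have : ((8 * P.L / 2 ^ s : ℕ) : ℝ) ≤ 8 * (P.L : ℝ) / (2 : ℝ) ^ s := by
        have := Nat.cast_div_le (α := ℝ) (m := 8 * P.L) (n := 2 ^ s)
        push_cast at this
        exact this
      linarith
  calc ∑ s ∈ Icc 1 P.Sd, ((P.T s : ℕ) : ℝ) ≤ ∑ s ∈ Icc 1 P.Sd, (8 * (P.L : ℝ) / (2 : ℝ) ^ s + 1) := sum_le_sum h1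
    _ = 8 * (P.L : ℝ) * (1 - 1 / (2 : ℝ) ^ P.Sd) + P.Sd := by
        rw [sum_add_distrib, sum_Icc_div_two_pow, sum_const, Nat.card_Icc]; simp
    _ ≤ 8 * P.L + P.Sd := by
        have : 0 ≤ 8 * (P.L : ℝ) * (1 / (2 : ℝ) ^ P.Sd) := by have := P.L_real.2.1; positivity
        linarith

/-- **The level-`0` order from above**: `Mord 0 0 ≤ 16(n+1)L·(1 + 1/(n+2)³) + (n+1)·Ŝ`. [cite: Nesterenko2003, (4.5); shape only] -/
theorem Mord_zero_le : (P.Mord 0 0 : ℝ) ≤ 16 * (n + 1) * P.L * (1 + 1 / ((n : ℝ) + 2) ^ 3) + (n + 1) * P.Sd := by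
  have hT0 : P.T 0 = 8 * P.L := by
    unfold ArchG3Rec.T
    rw [pow_zero, Nat.div_one]
    exact max_eq_right (by have := P.L_floors.1; have : 1 ≤ 2 ^ (n + 25) := Nat.one_le_two_pow; omega)
  unfold ArchG3Rec.Mord
  rw [hT0, Nat.sub_zero]
  have hM : ((P.M / (n + 2) ^ 3 : ℕ) : ℝ) ≤ 16 * (n + 1) * (P.L : ℝ) / ((n : ℝ) + 2) ^ 3 := by
    have := Nat.cast_div_le (α := ℝ) (m := P.M) (n := (n + 2) ^ 3)
    unfold ArchG3Rec.M at this ⊢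
    push_cast at this ⊢
    exact this
  have hR := P.R_one_le
  push_cast
  have hn : (0 : ℝ) ≤ n := Nat.cast_nonneg n
  have hpos : (0 : ℝ) < ((n : ℝ) + 2) ^ 3 := by positivity
  have e1 : 16 * ((n : ℝ) + 1) * P.L * (1 + 1 / ((n : ℝ) + 2) ^ 3) =
      16 * (n + 1) * P.L + 16 * (n + 1) * (P.L : ℝ) / ((n : ℝ) + 2) ^ 3 := by field_simp
  rw [e1]
  nlinarith

/-! ### The depth atom `n·(Ŝ + 1) ≤ 4L` -/

/-- `n² ≤ 2^{n+1}`. [folklore] -/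
theorem sq_le_two_pow_succ (n : ℕ) : n * n ≤ 2 ^ (n + 1) := by
  induction n with
  | zero => simp
  | succ k ih =>
    have h2 : 2 * k + 1 ≤ 2 ^ (k + 1) := by
      have : k + 1 ≤ 2 ^ k := Nat.lt_two_pow_self
      rw [pow_succ]; omega
    calc (k + 1) * (k + 1) = k * k + (2 * k + 1) := by ring
      _ ≤ 2 ^ (k + 1) + 2 ^ (k + 1) := Nat.add_le_add ih h2
      _ = 2 ^ (k + 1 + 1) := by rw [pow_succ]; ring

/-- `log K ≤ 9n + 12` (`K ≤ n·e^{8n+10} + 2 ≤ 3n·e^{8n+10}`, `log n ≤ n − 1`, `log 3 ≤ 2`). [folklore] -/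
theorem log_K_le (hn : 1 ≤ n) : Real.log (K n) ≤ 9 * n + 12 := by
  have hK := K_le n
  rw [G_eq] at hK
  have hn1 : (1 : ℝ) ≤ n := by exact_mod_cast hn
  have he1 : (1 : ℝ) ≤ exp (8 * (n + 1) + 2) := Real.one_le_exp (by positivity)
  have hK3 : (K n : ℝ) ≤ 3 * n * exp (8 * (n + 1) + 2) := by nlinarith
  have hKpos : (0 : ℝ) < K n := K_pos n
  calc Real.log (K n) ≤ Real.log (3 * n * exp (8 * (n + 1) + 2)) := Real.log_le_log hKpos hK3
    _ = Real.log 3 + Real.log n + (8 * (n + 1) + 2) := by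
        rw [Real.log_mul (by positivity) (by positivity), Real.log_mul (by norm_num) (by positivity), Real.log_exp]
    _ ≤ (3 - 1) + (n - 1) + (8 * (n + 1) + 2) := by
        gcongr
        · exact Real.log_le_sub_one_of_pos (by norm_num)
        · exact Real.log_le_sub_one_of_pos (by positivity)
    _ ≤ 9 * n + 12 := by linarith

/-- `log N ≤ 2n + log Ω` (`N ≤ (2/log 2)ⁿ·Ω`, `log(2/log 2) ≤ 2`). [cite: Nesterenko2003, §3.4 Prop. 3.7 (3.16); shape only] -/
theorem log_N_le : Real.log P.N ≤ 2 * n + Real.log P.Ω := by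
  have hN := P.N_facts
  have hΩ := P.Ω_facts
  have hl2 := Real.log_two_gt_d9
  have hq0 : (0 : ℝ) < 2 / Real.log 2 := by positivity
  have hq : Real.log (2 / Real.log 2) ≤ 2 := by
    have h1 := Real.log_le_sub_one_of_pos hq0
    have h2 : 2 / Real.log 2 ≤ 3 := by rw [div_le_iff₀ (by linarith)]; linarith
    linarith
  calc Real.log P.N ≤ Real.log ((2 / Real.log 2) ^ n * P.Ω) := Real.log_le_log hN.1 P.hNΩ
    _ = n * Real.log (2 / Real.log 2) + Real.log P.Ω := by rw [Real.log_mul (by positivity) hΩ.1.ne', Real.log_pow]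
    _ ≤ n * 2 + Real.log P.Ω := by have : (0:ℝ) ≤ n := Nat.cast_nonneg n; nlinarith
    _ = 2 * n + Real.log P.Ω := by ring

/-- **The core of `L` against the saturation data**: `48·C_bⁿ·Ω·K ≤ L·(1 + 2n + log Ω)` (`core_le_L`, `yload_K ≥ 2G`, `W/WN ≥ 1/(1 + log N)`,
`log N ≤ 2n + log Ω`). [cite: Nesterenko2003, §3.5 (3.23); shape only] -/
theorem core_le_L_mul : 48 * Cb ^ n * P.Ω * K n ≤ P.L * (1 + 2 * n + Real.log P.Ω) := by
  have hc := P.core_le_L.1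
  have hy := two_G_le_yloadK n
  have hG := G_pos n
  have hW := P.hW
  have hN := P.N_facts
  have hlogN := P.log_N_le
  have hWN : P.WN = P.W + Real.log P.N := rfl
  have hL := P.L_real.2.1
  have hA0 : 0 ≤ 24 * Cb ^ n * P.Ω * K n * P.W := by
    have := P.Ω_facts.1; have := K_pos n; have := Cb_pos; positivity
  -- `48 C Ω K · W · G ≤ G · WN · L`
  have h1 : G n * (2 * (24 * Cb ^ n * P.Ω * K n * P.W)) ≤ G n * (P.WN * P.L) := by
    have h := mul_le_mul_of_nonneg_left hy hA0
    calc G n * (2 * (24 * Cb ^ n * P.Ω * K n * P.W)) = 24 * Cb ^ n * P.Ω * K n * P.W * (2 * G n) := by ring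
      _ ≤ 24 * Cb ^ n * P.Ω * K n * P.W * yloadK n := h
      _ = 24 * Cb ^ n * P.Ω * K n * yloadK n * P.W := by ring
      _ ≤ G n * P.WN * P.L := hc
      _ = G n * (P.WN * P.L) := by ring
  have h2 : 2 * (24 * Cb ^ n * P.Ω * K n * P.W) ≤ P.WN * P.L := le_of_mul_le_mul_left h1 hG
  -- `WN ≤ W (1 + log N)` and divide by `W`
  have h3 : P.WN ≤ P.W * (1 + Real.log P.N) := by rw [hWN]; nlinarith [hN.2.2]
  have h4 : P.W * (48 * Cb ^ n * P.Ω * K n) ≤ P.W * ((1 + Real.log P.N) * P.L) := by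
    have h5 : P.WN * P.L ≤ P.W * (1 + Real.log P.N) * P.L := mul_le_mul_of_nonneg_right h3 hL.le
    calc P.W * (48 * Cb ^ n * P.Ω * K n) = 2 * (24 * Cb ^ n * P.Ω * K n * P.W) := by ring
      _ ≤ P.WN * P.L := h2
      _ ≤ P.W * (1 + Real.log P.N) * P.L := h5
      _ = P.W * ((1 + Real.log P.N) * P.L) := by ring
  have h6 : 48 * Cb ^ n * P.Ω * K n ≤ (1 + Real.log P.N) * P.L := le_of_mul_le_mul_left h4 (by linarith)
  have h7 : (1 + Real.log P.N) * P.L ≤ (1 + 2 * n + Real.log P.Ω) * P.L :=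
    mul_le_mul_of_nonneg_right (by linarith) hL.le
  linarith

/-- `log Ω ≤ 2√Ω` and `(log Ω)² ≤ 4Ω` (`Ω ≥ 1`). [folklore] -/
theorem log_Ω_le_sqrt : Real.log P.Ω ≤ 2 * √P.Ω ∧ Real.log P.Ω ^ 2 ≤ 4 * P.Ω ∧ 0 ≤ Real.log P.Ω := by
  have hΩ := P.Ω_facts
  have hs : 0 < √P.Ω := Real.sqrt_pos.mpr hΩ.1
  have h1 : Real.log P.Ω = 2 * Real.log (√P.Ω) := by rw [Real.log_sqrt hΩ.1.le]; ring
  have h2 : Real.log (√P.Ω) ≤ √P.Ω - 1 := Real.log_le_sub_one_of_pos hs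
  have hlog0 : 0 ≤ Real.log P.Ω := Real.log_nonneg hΩ.2.1
  have h3 : Real.log P.Ω ≤ 2 * √P.Ω := by rw [h1]; linarith
  refine ⟨h3, ?_, hlog0⟩
  have h4 : Real.log P.Ω ^ 2 ≤ (2 * √P.Ω) ^ 2 := pow_le_pow_left₀ hlog0 h3 2
  have h5 : (2 * √P.Ω) ^ 2 = 4 * P.Ω := by rw [mul_pow, Real.sq_sqrt hΩ.1.le]; ring
  linarith

/-- The polynomial part of the depth atom: `n(n+25) + n(11n+12)/log 2 ≤ L/8` (`n² ≤ 2^{n+1}`, `L ≥ 2^{n+25}`). [folklore] -/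
theorem depth_poly_le : (n : ℝ) * (n + 25) + n * ((9 * n + 12) + 2 * n) / Real.log 2 ≤ P.L / 8 := by
  have hl2 := Real.log_two_gt_d9
  have hL := P.L_real
  have hn0 : (0 : ℝ) ≤ n := Nat.cast_nonneg n
  have hsq : (n : ℝ) * n ≤ 2 ^ (n + 1) := by exact_mod_cast sq_le_two_pow_succ n
  have h1 : (n : ℝ) * ((9 * n + 12) + 2 * n) / Real.log 2 ≤ n * ((9 * n + 12) + 2 * n) * (3 / 2) := by
    rw [div_le_iff₀ (by linarith)]
    have : 0 ≤ (n : ℝ) * ((9 * n + 12) + 2 * n) := by positivity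
    nlinarith
  have hn1 : (n : ℝ) ≤ n * n ∨ (n : ℝ) = 0 := by
    rcases Nat.eq_zero_or_pos n with h | h
    · right; exact_mod_cast h
    · left; have : (1 : ℝ) ≤ n := by exact_mod_cast h
      nlinarith
  have h2 : (n : ℝ) * (n + 25) + n * ((9 * n + 12) + 2 * n) * (3 / 2) ≤ 61 * (n * n) := by
    rcases hn1 with h | h
    · nlinarith
    · rw [h]; norm_num
  have h4 : (61 : ℝ) * 2 ^ (n + 1) ≤ (2 : ℝ) ^ (n + 25) / 8 := by
    rw [show (2 : ℝ) ^ (n + 25) = 2 ^ (n + 1) * 2 ^ 24 by rw [← pow_add]]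
    have : (0 : ℝ) < 2 ^ (n + 1) := by positivity
    nlinarith
  linarith [hL.2.2.1]

/-- The `log Ω` part of the depth atom: `n·log Ω/log 2 ≤ 3L` (`n log Ω (1 + 2n + log Ω) ≤ (4n² + 6n)Ω ≤ 96 C_bⁿ K Ω ≤ 2L(1 + 2n + log Ω)`).
[folklore] -/
theorem depth_logΩ_le : (n : ℝ) * Real.log P.Ω / Real.log 2 ≤ 3 * P.L := by
  have hl2 := Real.log_two_gt_d9
  have hΩ := P.Ω_facts
  have hL := P.L_real
  have hn0 : (0 : ℝ) ≤ n := Nat.cast_nonneg n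
  obtain ⟨hl1, hl2', hl0⟩ := P.log_Ω_le_sqrt
  have hcore := P.core_le_L_mul
  rw [div_le_iff₀ (by linarith)]
  have hs1 : √P.Ω ≤ P.Ω := by
    have h := Real.sqrt_le_sqrt hΩ.2.1
    rw [Real.sqrt_one] at h
    have h2 := Real.sq_sqrt hΩ.1.le
    nlinarith [Real.sqrt_nonneg P.Ω]
  have hA : (n : ℝ) * Real.log P.Ω * (1 + 2 * n + Real.log P.Ω) ≤ (4 * n * n + 6 * n) * P.Ω := by
    have h1 : Real.log P.Ω ≤ 2 * P.Ω := by linarith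
    have h1' : (n : ℝ) * (1 + 2 * n) * Real.log P.Ω ≤ n * (1 + 2 * n) * (2 * P.Ω) :=
      mul_le_mul_of_nonneg_left h1 (by positivity)
    have h2' : (n : ℝ) * Real.log P.Ω ^ 2 ≤ n * (4 * P.Ω) := mul_le_mul_of_nonneg_left hl2' hn0
    have e1 : (n : ℝ) * Real.log P.Ω * (1 + 2 * n + Real.log P.Ω) =
        n * (1 + 2 * n) * Real.log P.Ω + n * Real.log P.Ω ^ 2 := by ring
    have e2 : (4 * (n : ℝ) * n + 6 * n) * P.Ω = n * (1 + 2 * n) * (2 * P.Ω) + n * (4 * P.Ω) := by ring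
    rw [e1, e2]
    exact add_le_add h1' h2'
  have hB : (4 * (n : ℝ) * n + 6 * n) ≤ 96 * Cb ^ n * K n := by
    have hK1 : (1 : ℝ) ≤ K n := by exact_mod_cast one_le_K n
    have hCb : (10 : ℝ) ≤ Cb := by rw [Cb_eq]; have := Real.exp_one_gt_d9; linarith
    have hsq : (n : ℝ) * n ≤ 2 ^ (n + 1) := by exact_mod_cast sq_le_two_pow_succ n
    have hn2 : (n : ℝ) ≤ 2 ^ n := by exact_mod_cast (Nat.lt_two_pow_self (n := n)).le
    have h2n : (2 : ℝ) ^ n ≤ Cb ^ n := pow_le_pow_left₀ (by norm_num) (by linarith) n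
    have hC0 : (0 : ℝ) ≤ Cb ^ n := by have := Cb_pos; positivity
    have e : (2 : ℝ) ^ (n + 1) = 2 * 2 ^ n := by rw [pow_succ]; ring
    rw [e] at hsq
    nlinarith
  have hden : 0 < 1 + 2 * (n : ℝ) + Real.log P.Ω := by positivity
  have hC : (n : ℝ) * Real.log P.Ω * (1 + 2 * n + Real.log P.Ω) ≤ (2 * P.L) * (1 + 2 * n + Real.log P.Ω) := by
    calc (n : ℝ) * Real.log P.Ω * (1 + 2 * n + Real.log P.Ω) ≤ (4 * n * n + 6 * n) * P.Ω := hA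
      _ ≤ (96 * Cb ^ n * K n) * P.Ω := mul_le_mul_of_nonneg_right hB hΩ.1.le
      _ = 2 * (48 * Cb ^ n * P.Ω * K n) := by ring
      _ ≤ 2 * (P.L * (1 + 2 * n + Real.log P.Ω)) := by linarith
      _ = (2 * P.L) * (1 + 2 * n + Real.log P.Ω) := by ring
  have hD : (n : ℝ) * Real.log P.Ω ≤ 2 * P.L := le_of_mul_le_mul_right hC hden
  nlinarith [hL.1]

/-- **THE DEPTH ATOM**: `n·(Ŝ + 1) ≤ 4·L` — through `Ŝ = n + 24 + ⌊log₂(K·N)⌋`, `log K ≤ 9n + 12`, `log N ≤ 2n + log Ω`, `L ≥ 2^{n+25}` for the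
polynomial part and `L·(1 + 2n + log Ω) ≥ 48·C_bⁿ·Ω·K`, `log Ω ≤ 2√Ω` for the `log Ω` part (a `2^{−n}`-class atom; the floor `4(Ŝ+2) ≤ L`
is NOT used). [cite: Nesterenko2003, (3.24) with §3.5 (3.23); shape only] -/
theorem n_mul_Sd_le : (n : ℝ) * (P.Sd + 1) ≤ 4 * P.L := by
  have hn1 : 1 ≤ n := P.hn
  have hn0 : (0 : ℝ) ≤ n := Nat.cast_nonneg n
  have hl2 := Real.log_two_gt_d9
  have hN := P.N_facts
  -- `Ŝ ≤ n + 24 + log₂(K N)`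
  have hSd : (P.Sd : ℝ) ≤ n + 24 + (Real.log (K n) + Real.log P.N) / Real.log 2 := by
    have e : (P.Sd : ℝ) = n + 24 + (Nat.log 2 (K n * P.N) : ℝ) := by unfold ArchG3Rec.Sd; push_cast; ring
    rw [e]
    have h1 : (Nat.log 2 (K n * P.N) : ℝ) ≤ Real.logb 2 (K n * P.N : ℕ) := Real.natLog_le_logb _ _
    have h2 : Real.logb 2 ((K n * P.N : ℕ) : ℝ) = (Real.log (K n) + Real.log P.N) / Real.log 2 := by
      rw [Real.logb]; push_cast
      rw [Real.log_mul (K_pos n).ne' hN.1.ne']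
    linarith [h1, h2.le, h2.ge]
  have hK := log_K_le hn1
  have hNl := P.log_N_le
  have hpoly := P.depth_poly_le
  have hΩpart := P.depth_logΩ_le
  have e1 : (n : ℝ) * (P.Sd + 1) ≤ n * (n + 25 + (Real.log (K n) + Real.log P.N) / Real.log 2) :=
    mul_le_mul_of_nonneg_left (by linarith) hn0
  have h1 : (Real.log (K n) + Real.log P.N) / Real.log 2 ≤ (((9 * n + 12) + 2 * n) + Real.log P.Ω) / Real.log 2 :=
    div_le_div_of_nonneg_right (by linarith) (by linarith)
  have e2 : (n : ℝ) * (n + 25 + (Real.log (K n) + Real.log P.N) / Real.log 2) ≤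
      n * (n + 25) + n * ((9 * n + 12) + 2 * n) / Real.log 2 + n * Real.log P.Ω / Real.log 2 := by
    have h3 : (n : ℝ) * (n + 25 + (((9 * n + 12) + 2 * n) + Real.log P.Ω) / Real.log 2) =
        n * (n + 25) + n * ((9 * n + 12) + 2 * n) / Real.log 2 + n * Real.log P.Ω / Real.log 2 := by ring
    rw [← h3]
    exact mul_le_mul_of_nonneg_left (by linarith) hn0
  linarith


end ArchG3Rec

end Summit.ABC.StewartYu

end
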